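import Mathlib.Algebra.BigOperators.Fin
import Literature.Geometry.Lorentzian.Genericity
import HarnessLib

/-!
# Discharged fact: monotonicity of Christodoulou's linear codimension

`Literature.Geometry.Lorentzian.Genericity` records the monotonicity of the linear
finite-codimension notion `HasLinearCodimAtLeast 𝓓 𝓔 m` in `m` as a named fact
(`def HasLinearCodimAtLeast.mono : Prop`). It is proved here (`HasLinearCodimAtLeast.mono_holds`),
so that users holding `(h : HasLinearCodimAtLeast.mono)` can discharge the hypothesis: from `n`
linearly independent directions `f₁, …, fₙ` through an exceptional datum one keeps the first `m`;
the shorter affine family is the longer one at parameters `(c₁, …, cₘ, 0, …, 0)`.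

The proof lives in a separate file because `Genericity.lean` is a definitions file (every edit of
it is review-queued), while this file adds no definition.

## References

* D. Christodoulou, *On the global initial value problem and the issue of singularities*,
  Class. Quantum Grav. **16** (1999) A23–A35, p. A24 (finite-codimension genericity; notation
  only).
-/

open scoped BigOperators

namespace Literature.Geometry.Lorentzian

variable {V : Type*} [AddCommGroup V] [Module ℝ V]

/-- Dropping the last direction: linear codimension at least `m + 1` implies at least `m`. The
family on `f ∘ Fin.castSucc` with parameters `c` is the original family at `Fin.snoc c 0`.
[folklore] -/
theorem HasLinearCodimAtLeast.of_succ {𝓓 𝓔 : Set V} {m : ℕ}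
    (h : HasLinearCodimAtLeast 𝓓 𝓔 (m + 1)) : HasLinearCodimAtLeast 𝓓 𝓔 m := by
  intro d hd
  obtain ⟨f, hf, hD, hE⟩ := h d hd
  have key : ∀ c : Fin m → ℝ,
      ∑ i, c i • (f ∘ Fin.castSucc) i = ∑ j, (Fin.snoc c (0 : ℝ) : Fin (m + 1) → ℝ) j • f j := by
    intro c
    rw [Fin.sum_univ_castSucc]
    simp
  refine ⟨f ∘ Fin.castSucc, hf.comp _ (Fin.castSucc_injective m), fun c => ?_, fun c hc => ?_⟩
  · rw [key]
    exact hD _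
  · have h0 : (Fin.snoc c (0 : ℝ) : Fin (m + 1) → ℝ) ≠ 0 := by
      intro h0
      apply hc
      funext i
      simpa using congr_fun h0 (Fin.castSucc i)
    rw [key]
    exact hE _ h0

/-- Discharge of the named fact `HasLinearCodimAtLeast.mono`: linear codimension is monotone in
the number of directions (iterate `HasLinearCodimAtLeast.of_succ`). [folklore] -/
theorem HasLinearCodimAtLeast.mono_holds : HasLinearCodimAtLeast.mono (V := V) := by
  intro 𝓓 𝓔 m n hmn h
  induction n, hmn using Nat.le_induction with
  | base => exact h
  | succ n _ ih => exact ih h.of_succ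

end Literature.Geometry.Lorentzian
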